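import Literature.Computability.Cryptography.ShorProofs
import Literature.Computability.Cryptography.PeriodisedFourierWindows
import Literature.Computability.Complexity.CodeFP
import HarnessLib

/-!
# The classical oracle of the van Dam–Seroussi Gauss-sum algorithm: queries and their semantics

Topic `Literature/Computability/Cryptography`; support for the discharge of
`VanDamSeroussi2002_gaussSumPhase_qsolvable` (van Dam–Seroussi 2002, Thm. 1: the phase of a Gauss
sum over `𝔽_p` is estimated in quantum polynomial time). In the tree's model the algorithm is a
polynomial-time GENERATED Clifford+`T` circuit with oracle gates for ONE language `A ∈ BQP`
(`QuantumComplexity/GeneratedOracleSubst.lean`: `BQP^BQP = BQP`, Bennett–Bernstein–Brassard–Vazirani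
1997, Cor. 4.15), and every CLASSICAL step of the printed algorithm is a query to that oracle,
answered bit by bit into clean wires (Bennett 1973: compute – use – uncompute by asking again):

* the discrete logarithms behind the character values `χ(y) = e(a·ind_g(y)/(p−1))` of the state
  `|χ⟩` (van Dam–Seroussi 2002, §3 Lemma 1: "`|χ⟩` can be prepared using Shor's discrete logarithm
  algorithm"), guarded by a CERTIFICATE `F` of the primitivity of `g` — the prime factorisation of
  `p − 1`, itself fetched from the oracle (Shor: factoring) — so that the language is well defined
  and decidable with bounded error on EVERY query (`VDSOracle.CertOK`, `orderOf_eq_of_certOK`);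
* the binary digits of the phase fractions `frac(e·d/(p−1))` (`VDSOracle.phaseNum`);
* the modular arithmetic of the state preparation (`yOfT`, `qOfT`, `tOfQY`), of the periodisation
  `z = y + p·j` of the approximate Fourier transform over `ℤ_p` (Hales–Hallgren 2000 / Hales 2002,
  Ch. 5: `addMul`, `% p`, `/ p`) and of its division step (`Hales2002.kOf/near/rOff` of
  `PeriodisedFourierWindows.lean`, and `unz` undoing it, `unz_kOf_rOff`).

This file fixes the QUERY FORMAT and the SEMANTICS (everything proved, no named fact):

* `VDSOracle.dlog p g y` — the discrete logarithm (the unique element of `dlogSolutions p g y` on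
  instances, `dlog_mem`, `eq_dlog`); `VDSOracle.CertOK p g F` and **`orderOf_eq_of_certOK`** (a list of
  primes with product `p − 1` at each of which `g^{(p−1)/r} ≢ 1` certifies `ord_p(g) = p − 1`;
  Lucas 1876 / Lehmer 1927, the tree's `orderOf_eq_of_pow_and_pow_div_prime`) with the converse
  `certOK_primeFactorsList`;
* the query tuple `VDSOracle.Query` (the input `x = ⟨bin p, ⟨bin g, ⟨bin a, bin b⟩⟩⟩` of the
  algorithm, a tag, a bit index, a precision parameter, a register width, and the RAW register
  contents — quantum wires enter a query only in the last, undoubled, field), its total parser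
  `VDSOracle.parse` (`parse_encodeQ`), the certificate parser `parseF` (`parseF_factCode_append`);
* the answer bit `VDSOracle.specBit` (by tag) and the language **`VDSOracle.lang`**.

Membership `lang ∈ BQP` (Shor 1997 §5–§6 inside one classical wrap) and the circuit are sequels.

## References

* W. van Dam, G. Seroussi, *Efficient quantum algorithms for estimating Gauss sums*,
  arXiv:quant-ph/0207131 (2002), §3 (Lemma 1), §4 (Algorithm 1, Thm. 1) [VanDamSeroussi2002].
* P. W. Shor, SIAM J. Comput. 26 (1997) 1484–1509, §5 (factoring), §6 (discrete logarithms) [Shor1997].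
* C. H. Bennett, E. Bernstein, G. Brassard, U. Vazirani, SIAM J. Comput. 26 (1997), Cor. 4.15
  [BennettBernsteinBrassardVazirani1997].
* L. Hales, *The quantum Fourier transform and extensions of the abelian hidden subgroup problem*,
  PhD thesis, UC Berkeley 2002 (arXiv:quant-ph/0212002), Ch. 5 §1 [Hales2002].
* D. H. Lehmer, *Tests for primality by the converse of Fermat's theorem*, Bull. AMS 33 (1927) [folklore: Lucas–Lehmer primitive-root certificate].
-/

noncomputable section

namespace Literature.Computability.Cryptography

namespace VDSOracle

open _root_.Computability Complexity Complexity.Brick Complexity.CodeFP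
open Hales2002 (kOf near rOff near_le kOf_lt rOff_lt)

/-! ### Discrete logarithms -/

open Classical in
/-- **The discrete logarithm** `ind_g(y)`: the least `a < p − 1` with `g^a ≡ y (mod p)` (`0` if there
is none). [cite: Shor1997, §6] -/
def dlog (p g y : ℕ) : ℕ := if h : ∃ a, a ∈ dlogSolutions p g y then Nat.find h else 0

/-- On an instance the discrete logarithm is a solution. [cite: Shor1997, §6] -/
theorem dlog_mem {p g y : ℕ} (h : IsDLogInstance p g y) : dlog p g y ∈ dlogSolutions p g y := by
  classical
  obtain ⟨a, ha, -⟩ := existsUnique_mem_dlogSolutions_holds h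
  have hex : ∃ a, a ∈ dlogSolutions p g y := ⟨a, ha⟩
  rw [dlog, dif_pos hex]
  exact Nat.find_spec hex

/-- On an instance every solution is the discrete logarithm. [cite: Shor1997, §6] -/
theorem eq_dlog {p g y a : ℕ} (h : IsDLogInstance p g y) (ha : a ∈ dlogSolutions p g y) : a = dlog p g y :=
  (existsUnique_mem_dlogSolutions_holds h).unique ha (dlog_mem h)

/-- The discrete logarithm is below `p − 1` (for `p ≥ 2`). [folklore] -/
theorem dlog_lt {p : ℕ} (hp : 2 ≤ p) (g y : ℕ) : dlog p g y < p - 1 := by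
  classical
  unfold dlog
  split_ifs with h
  · exact ((mem_dlogSolutions p g y _).1 (Nat.find_spec h)).1
  · omega

/-- On an instance, `g ^ dlog ≡ y (mod p)`. [cite: Shor1997, §6] -/
theorem pow_dlog_modEq {p g y : ℕ} (h : IsDLogInstance p g y) : g ^ dlog p g y ≡ y [MOD p] :=
  ((mem_dlogSolutions p g y _).1 (dlog_mem h)).2

/-- On an instance, `(g : ZMod p) ^ dlog = y`. [cite: Shor1997, §6] -/
theorem natCast_pow_dlog {p g y : ℕ} (h : IsDLogInstance p g y) : ((g : ZMod p)) ^ dlog p g y = (y : ZMod p) := by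
  have := (ZMod.natCast_eq_natCast_iff _ _ _).2 (pow_dlog_modEq h)
  push_cast at this
  exact this

/-! ### The certificate of a primitive root -/

/-- **A primitive-root certificate**: `p` is prime, `0 < g < p`, `F` is a list of primes with product
`p − 1`, and `g^{(p−1)/r} ≢ 1 (mod p)` for every `r ∈ F`. [cite: Shor1997, §6 (the promise of the discrete-log problem: g a generator)] -/
def CertOK (p g : ℕ) (F : List ℕ) : Prop :=
  p.Prime ∧ 0 < g ∧ g < p ∧ (∀ r ∈ F, r.Prime) ∧ F.prod = p - 1 ∧ ∀ r ∈ F, ¬ g ^ ((p - 1) / r) ≡ 1 [MOD p]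

/-- The certificate condition is decidable. [folklore] -/
instance (p g : ℕ) (F : List ℕ) : Decidable (CertOK p g F) := by unfold CertOK; infer_instance

/-- **A certified `g` has order `p − 1`** (Lucas's converse of Fermat's theorem, order form).
[cite: Shor1997, §6] -/
theorem orderOf_eq_of_certOK {p g : ℕ} {F : List ℕ} (h : CertOK p g F) : orderOf (g : ZMod p) = p - 1 := by
  obtain ⟨hp, hg0, hgp, hprime, hprod, hne⟩ := h
  haveI : Fact p.Prime := ⟨hp⟩
  have hgz : (g : ZMod p) ≠ 0 := by
    rw [Ne, ZMod.natCast_eq_zero_iff]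
    exact fun hd => absurd (Nat.le_of_dvd hg0 hd) (not_le.2 hgp)
  refine orderOf_eq_of_pow_and_pow_div_prime (by have := hp.two_le; omega) (ZMod.pow_card_sub_one_eq_one hgz) ?_
  intro q hq hqd
  -- `q` is one of the certified primes
  have hqF : q ∈ F := by
    rw [← hprod] at hqd
    obtain ⟨r, hr, hqr⟩ := (Prime.dvd_prod_iff (Nat.prime_iff.1 hq)).1 hqd
    rwa [(Nat.prime_dvd_prime_iff_eq hq (hprime r hr)).1 hqr]
  intro h1
  apply hne q hqF
  rw [← ZMod.natCast_eq_natCast_iff]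
  push_cast
  exact h1

/-- A certified query is a discrete-log instance for every unit `y`. [cite: Shor1997, §6] -/
theorem isDLogInstance_of_certOK {p g : ℕ} {F : List ℕ} (h : CertOK p g F) {y : ℕ} (hy0 : 0 < y) (hyp : y < p) :
    IsDLogInstance p g y :=
  ⟨h.1, h.2.1, h.2.2.1, orderOf_eq_of_certOK h, hy0, hyp⟩

/-- **The canonical certificate is valid**: for `p` prime and `g` of order `p − 1`, the prime
factorisation of `p − 1` certifies `g`. [cite: Shor1997, §5 and §6] -/
theorem certOK_primeFactorsList {p g : ℕ} (hp : p.Prime) (hg0 : 0 < g) (hgp : g < p)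
    (hord : orderOf (g : ZMod p) = p - 1) : CertOK p g (p - 1).primeFactorsList := by
  have hp1 : p - 1 ≠ 0 := by have := hp.two_le; omega
  refine ⟨hp, hg0, hgp, fun r hr => Nat.prime_of_mem_primeFactorsList hr, Nat.prod_primeFactorsList hp1, fun r hrm h1 => ?_⟩
  have hr : r.Prime := Nat.prime_of_mem_primeFactorsList hrm
  have hrd : r ∣ p - 1 := Nat.dvd_of_mem_primeFactorsList hrm
  have hlt : (p - 1) / r < p - 1 := Nat.div_lt_self (Nat.pos_of_ne_zero hp1) hr.one_lt
  have hpos : (p - 1) / r ≠ 0 := (Nat.div_pos (Nat.le_of_dvd (Nat.pos_of_ne_zero hp1) hrd) hr.pos).ne'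
  have h1' : ((g : ZMod p)) ^ ((p - 1) / r) = 1 := by
    have := (ZMod.natCast_eq_natCast_iff _ _ _).2 h1
    push_cast at this
    exact this
  exact pow_ne_one_of_lt_orderOf hpos (hord ▸ hlt) h1'

/-- **The reduced representative of a primitive root is certified by the factorisation of `p − 1`.**
For `p` prime and `g : ℕ` whose residue is a primitive `(p−1)`-th root of unity (any representative),
`g mod p` with the prime factorisation of `p − 1` is a valid certificate. [cite: Shor1997, §6] -/
theorem certOK_mod_primeFactorsList {p g : ℕ} (hp : p.Prime) (hg : IsPrimitiveRoot (g : ZMod p) (p - 1)) :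
    CertOK p (g % p) (p - 1).primeFactorsList := by
  haveI : Fact p.Prime := ⟨hp⟩
  have hp2 := hp.two_le
  have hcast : ((g % p : ℕ) : ZMod p) = (g : ZMod p) := by rw [ZMod.natCast_mod]
  have hord : orderOf ((g % p : ℕ) : ZMod p) = p - 1 := by rw [hcast]; exact hg.eq_orderOf.symm
  have hne : ((g % p : ℕ) : ZMod p) ≠ 0 := by
    intro h0
    rw [h0, orderOf_eq_zero_iff'.2 (fun n hn h1 => by rw [zero_pow (by omega)] at h1; exact zero_ne_one h1)] at hord
    omega
  have hg0 : 0 < g % p := by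
    rw [Nat.pos_iff_ne_zero]
    intro h0
    rw [h0, Nat.cast_zero] at hne
    exact hne rfl
  exact certOK_primeFactorsList hp hg0 (Nat.mod_lt _ hp.pos) hord

/-! ### The arithmetic of the core -/

/-- State preparation: the unit `y = 1 + (t mod (p − 1))` selected by the uniform counter `t`.
[cite: VanDamSeroussi2002, §3 Lemma 1] -/
def yOfT (p t : ℕ) : ℕ := 1 + t % (p - 1)

/-- The junk quotient `t / (p − 1)` of the counter. [folklore] -/
def qOfT (p t : ℕ) : ℕ := t / (p - 1)

/-- The counter recovered from quotient and unit: `q (p − 1) + (y − 1)` (erases the counter).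
[folklore] -/
def tOfQY (p q y : ℕ) : ℕ := q * (p - 1) + (y - 1)

/-- The counter is recovered from its quotient and unit. [folklore] -/
theorem tOfQY_qOfT_yOfT (p t : ℕ) : tOfQY p (qOfT p t) (yOfT p t) = t := by
  unfold tOfQY qOfT yOfT
  have := Nat.div_add_mod' t (p - 1)
  omega

/-- The selected unit lies in `[1, p − 1]` (for `p ≥ 2`). [folklore] -/
theorem yOfT_pos (p t : ℕ) : 0 < yOfT p t := by unfold yOfT; omega

/-- The selected unit lies in `[1, p − 1]` (for `p ≥ 2`). [folklore] -/
theorem yOfT_lt {p : ℕ} (hp : 2 ≤ p) (t : ℕ) : yOfT p t < p := by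
  unfold yOfT
  have := Nat.mod_lt t (show 0 < p - 1 by omega)
  omega

/-- Periodisation: `z = y + p j`. [cite: Hales2002, Ch. 5 §1 (Algorithm 3: repeat the input)] -/
def addMul (p y j : ℕ) : ℕ := y + p * j

/-- `(y + p j) mod p = y` and `(y + p j) / p = j` for `y < p`. [folklore] -/
theorem addMul_mod_div {p y : ℕ} (hy : y < p) (j : ℕ) : addMul p y j % p = y ∧ addMul p y j / p = j := by
  have hp : 0 < p := by omega
  unfold addMul
  constructor
  · rw [Nat.add_mul_mod_self_left, Nat.mod_eq_of_lt hy]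
  · rw [Nat.add_mul_div_left _ _ hp, Nat.div_eq_of_lt hy, zero_add]

/-- The point recovered from the residue `k = kOf z` and the offset `r = rOff k z` of the division step
of the periodised Fourier transform (`Hales2002.kOf`, `Hales2002.rOff`; erases the transform register).
[cite: Hales2002, Ch. 5 §1 (Algorithm 3, step 3: divide by Q/p and round)] -/
def unz (p Q k r : ℕ) : ℕ := (r + near p Q k) % Q

/-- `unz < Q` for `Q > 0`. [folklore] -/
theorem unz_lt {Q : ℕ} (hQ : 0 < Q) (p k r : ℕ) : unz p Q k r < Q := Nat.mod_lt _ hQ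

/-- **The point is recovered from residue and offset**: `unz (rOff z) = z` for `z < Q` when the
centre is at most `Q`. [folklore] -/
theorem unz_rOff {p Q i z : ℕ} (hz : z < Q) (hn : near p Q i ≤ Q) : unz p Q i (rOff p Q i z) = z := by
  unfold unz Hales2002.rOff
  rw [Nat.mod_add_mod, show z + Q - near p Q i + near p Q i = z + Q by omega, Nat.add_mod_right, Nat.mod_eq_of_lt hz]

/-- On `[0, Q)` the division step `z ↦ (kOf z, rOff (kOf z) z)` is undone by `unz` (for `p ≤ Q`).
[cite: Hales2002, Ch. 5 §1 Algorithm 3] -/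
theorem unz_kOf_rOff {p Q z : ℕ} (hp : 0 < p) (hpQ : p ≤ Q) (hz : z < Q) :
    unz p Q (kOf p Q z) (rOff p Q (kOf p Q z) z) = z :=
  unz_rOff hz (near_le (kOf_lt hp Q z) hpQ)

/-- **The phase numerator**: the first `L` binary digits of `frac(e d/(p−1))`, as the integer
`⌊2^L (e d mod (p−1))/(p−1)⌋`. [cite: VanDamSeroussi2002, §3 Lemma 1 (χ(g^j) = ζ_{p−1}^{αj})] -/
def phaseNum (p e L d : ℕ) : ℕ := 2 ^ L * (e * d % (p - 1)) / (p - 1)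

/-- The phase numerator has `L` bits (for `p ≥ 2`). [folklore] -/
theorem phaseNum_lt {p : ℕ} (hp : 2 ≤ p) (e L d : ℕ) : phaseNum p e L d < 2 ^ L := by
  unfold phaseNum
  have h1 : 0 < p - 1 := by omega
  rw [Nat.div_lt_iff_lt_mul h1]
  exact Nat.mul_lt_mul_of_pos_left (Nat.mod_lt _ h1) (Nat.two_pow_pos L)

/-- **The phase numerator approximates the fraction**: `0 ≤ (e d mod (p−1))/(p−1) − phaseNum/2^L < 1/2^L`.
[folklore] -/
theorem phaseNum_div_le {p : ℕ} (hp : 2 ≤ p) (e L d : ℕ) :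
    (phaseNum p e L d : ℝ) / 2 ^ L ≤ ((e * d % (p - 1) : ℕ) : ℝ) / ((p : ℝ) - 1) ∧
      ((e * d % (p - 1) : ℕ) : ℝ) / ((p : ℝ) - 1) < (phaseNum p e L d : ℝ) / 2 ^ L + 1 / 2 ^ L := by
  have h1 : 0 < p - 1 := by omega
  have hp1 : ((p : ℝ) - 1) = ((p - 1 : ℕ) : ℝ) := by rw [Nat.cast_sub (by omega)]; simp
  have hpr : (0 : ℝ) < (p : ℝ) - 1 := by rw [hp1]; exact_mod_cast h1
  have h2L : (0 : ℝ) < 2 ^ L := by positivity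
  set m := e * d % (p - 1) with hm
  set N := 2 ^ L * m with hN
  have hdiv := Nat.div_add_mod N (p - 1)
  have hmod := Nat.mod_lt N h1
  have hq : phaseNum p e L d = N / (p - 1) := rfl
  rw [hq, hp1]
  have e1 : ((N / (p - 1) : ℕ) : ℝ) * ((p - 1 : ℕ) : ℝ) + ((N % (p - 1) : ℕ) : ℝ) = (2 : ℝ) ^ L * m := by
    have : ((p - 1) * (N / (p - 1)) + N % (p - 1) : ℕ) = 2 ^ L * m := by rw [hdiv]
    have := congrArg (Nat.cast : ℕ → ℝ) this
    push_cast at this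
    linarith
  have hpr' : (0 : ℝ) < ((p - 1 : ℕ) : ℝ) := by exact_mod_cast h1
  have hmodr : ((N % (p - 1) : ℕ) : ℝ) < ((p - 1 : ℕ) : ℝ) := by exact_mod_cast hmod
  have hmod0 : (0 : ℝ) ≤ ((N % (p - 1) : ℕ) : ℝ) := Nat.cast_nonneg _
  constructor
  · rw [div_le_div_iff₀ h2L hpr']
    nlinarith
  · rw [← add_div, div_lt_div_iff₀ hpr' h2L]
    nlinarith

/-! ### Queries -/

/-- **A parsed query**: the numerals `p, g, a, b` of the input of the algorithm, the tag, the bit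
index, the precision parameter, the width of the first register, and the raw register bits.
[cite: BennettBernsteinBrassardVazirani1997, Cor. 4.15 (queries to a BQP oracle)] -/
structure Query where
  /-- the modulus -/
  p : ℕ
  /-- the primitive root -/
  g : ℕ
  /-- the exponent of the character -/
  a : ℕ
  /-- the multiplier of the additive character -/
  b : ℕ
  /-- the tag of the query -/
  tag : ℕ
  /-- the bit index of the answer -/
  idx : ℕ
  /-- the precision parameter -/
  L : ℕ
  /-- the width of the first register -/
  w₁ : ℕ
  /-- the raw register bits -/
  regs : List Bool

namespace Query

/-- The first register. [folklore] -/
def r1 (q : Query) : List Bool := q.regs.take q.w₁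

/-- The second register. [folklore] -/
def r2 (q : Query) : List Bool := q.regs.drop q.w₁

end Query

/-- The input part `⟨bin p, ⟨bin g, ⟨bin a, bin b⟩⟩⟩` of the algorithm. [cite: VanDamSeroussi2002, §2.2 Def. 2 (the input (p, g, α), β)] -/
def xOf (p g a b : ℕ) : List Bool :=
  boolPair (encodeNat p) (boolPair (encodeNat g) (boolPair (encodeNat a) (encodeNat b)))

/-- **The query string**: `⟨x, ⟨1^tag, ⟨bin idx, ⟨1^L, ⟨1^{w₁}, regs⟩⟩⟩⟩⟩` — every doubled field is a
constant of the circuit; the register bits come last, undoubled. [folklore] -/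
def encodeQ (x : List Bool) (tag idx L w₁ : ℕ) (regs : List Bool) : List Bool :=
  boolPair x (boolPair (unE tag) (boolPair (encodeNat idx) (boolPair (unE L) (boolPair (unE w₁) regs))))

/-- **The total parser** of a query string (pair projections, values and lengths of the fields).
[folklore] -/
def parse (w : List Bool) : Query where
  p := bitsToNat (fstF (fstF w))
  g := bitsToNat (fstF (sndF (fstF w)))
  a := bitsToNat (fstF (sndF (sndF (fstF w))))
  b := bitsToNat (sndF (sndF (sndF (fstF w))))
  tag := (fstF (sndF w)).length
  idx := bitsToNat (fstF (sndF (sndF w)))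
  L := (fstF (sndF (sndF (sndF w)))).length
  w₁ := (fstF (sndF (sndF (sndF (sndF w))))).length
  regs := sndF (sndF (sndF (sndF (sndF w))))

/-- **The parser inverts the query encoding.** [folklore] -/
theorem parse_encodeQ (p g a b tag idx L w₁ : ℕ) (regs : List Bool) :
    parse (encodeQ (xOf p g a b) tag idx L w₁ regs) = ⟨p, g, a, b, tag, idx, L, w₁, regs⟩ := by
  simp [parse, encodeQ, xOf, fstF_boolPair, sndF_boolPair, bitsToNat_encodeNat, length_unE]

/-- **The certificate parser**: a register holding `listE bin F` followed by any padding is read as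
`F` (the unary header says how many items to take). [folklore] -/
def parseF (r : List Bool) : List ℕ := (List.range (fstF r).length).map fun j => bitsToNat (nthF j (sndF r))

/-- Reading item `j` of a raw list code followed by padding. [folklore] -/
theorem nthF_encList_append (l : List (List Bool)) (pad : List Bool) {j : ℕ} (hj : j < l.length) :
    nthF j (encList l ++ pad) = l[j] := by
  induction l generalizing j with
  | nil => simp at hj
  | cons c l ih =>
    have e : encList (c :: l) ++ pad = boolPair c (encList l ++ pad) := by
      rw [encList_cons, boolPair, boolPair]; simp [List.append_assoc]
    rw [e]
    cases j with
    | zero => rw [nthF_zero_boolPair]; rfl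
    | succ j => rw [nthF_succ_boolPair, ih (by simpa using hj)]; rfl

/-- The code of the certificate register: `listE bin F`. [folklore] -/
def certCode (F : List ℕ) : List Bool := listE natE F

/-- **The certificate parser reads the certificate through any padding.** [folklore] -/
theorem parseF_certCode_append (F : List ℕ) (pad : List Bool) : parseF (certCode F ++ pad) = F := by
  have e : certCode F ++ pad = boolPair (unE F.length) (encList (F.map natE) ++ pad) := by
    rw [certCode, listE, boolPair, boolPair, rawE]
    simp [List.append_assoc]
  rw [parseF, e, fstF_boolPair, sndF_boolPair, length_unE]
  apply List.ext_getElem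
  · simp
  · intro j h1 h2
    rw [List.getElem_map, List.getElem_range, nthF_encList_append _ _ (by simpa using h2), List.getElem_map]
    exact bitsToNat_encodeNat _

/-- The code of the FACTORISATION certificate of `p`: `listE bin (primeFactorsList (p − 1))` — what the
oracle's factoring queries spell out bit by bit. [cite: Shor1997, §5] -/
def factCode (p : ℕ) : List Bool := certCode (p - 1).primeFactorsList

/-! ### The answer bit -/

/-- The tags. [folklore] -/
def tagFACT : ℕ := 0
/-- The tags. [folklore] -/
def tagDLOG : ℕ := 1
/-- The tags. [folklore] -/
def tagPHASE : ℕ := 2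
/-- The tags. [folklore] -/
def tagYOFT : ℕ := 3
/-- The tags. [folklore] -/
def tagQOFT : ℕ := 4
/-- The tags. [folklore] -/
def tagTOFQY : ℕ := 5
/-- The tags. [folklore] -/
def tagADDMUL : ℕ := 6
/-- The tags. [folklore] -/
def tagMODP : ℕ := 7
/-- The tags. [folklore] -/
def tagDIVP : ℕ := 8
/-- The tags. [folklore] -/
def tagKOF : ℕ := 9
/-- The tags. [folklore] -/
def tagOFF : ℕ := 10
/-- The tags. [folklore] -/
def tagUNZ : ℕ := 11

/-- The exponent of the character of branch `s`: `a` (the input character) or `(p−1)/2` (the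
quadratic reference character). [cite: VanDamSeroussi2002, §4 (estimating γ against a known Gauss sum)] -/
def expOf (p a : ℕ) (s : Bool) : ℕ := if s then (p - 1) / 2 else a

/-- **The value asked by a query**, by tag: `1` (`DLOG`) the discrete logarithm of the second register
to the base `g mod p` (valid certificate in the first register and a unit, else `0`; the input `g` of the
algorithm is any representative of the primitive root); `2` (`PHASE`) the phase numerator of the
second register for the branch bit in the first; `3–5` state preparation; `6–8` periodisation;
`9–11` the division step (`Q = 2^{w₁}` resp. `2^L`). Tag `0` (`FACT`) is answered from `factCode`.
[cite: VanDamSeroussi2002, §4 Algorithm 1] -/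
def valOf (q : Query) : ℕ :=
  if q.tag = tagDLOG then
    (if CertOK q.p (q.g % q.p) (parseF q.r1) ∧ 0 < bitsToNat q.r2 ∧ bitsToNat q.r2 < q.p then
      dlog q.p (q.g % q.p) (bitsToNat q.r2) else 0)
  else if q.tag = tagPHASE then phaseNum q.p (expOf q.p q.a (q.r1.headD false)) q.L (bitsToNat q.r2)
  else if q.tag = tagYOFT then yOfT q.p (bitsToNat q.r1)
  else if q.tag = tagQOFT then qOfT q.p (bitsToNat q.r1)
  else if q.tag = tagTOFQY then tOfQY q.p (bitsToNat q.r1) (bitsToNat q.r2)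
  else if q.tag = tagADDMUL then addMul q.p (bitsToNat q.r1) (bitsToNat q.r2)
  else if q.tag = tagMODP then bitsToNat q.r1 % q.p
  else if q.tag = tagDIVP then bitsToNat q.r1 / q.p
  else if q.tag = tagKOF then kOf q.p (2 ^ q.w₁) (bitsToNat q.r1)
  else if q.tag = tagOFF then rOff q.p (2 ^ q.w₁) (kOf q.p (2 ^ q.w₁) (bitsToNat q.r1)) (bitsToNat q.r1)
  else if q.tag = tagUNZ then unz q.p (2 ^ q.L) (bitsToNat q.r1) (bitsToNat q.r2)
  else 0

/-- **The answer bit of a query**: bit `idx` of the factorisation code (tag `0`), else bit `idx` of the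
value asked. [cite: VanDamSeroussi2002, §4 Algorithm 1] -/
def specBit (q : Query) : Bool :=
  if q.tag = tagFACT then (factCode q.p).getD q.idx false else (valOf q).testBit q.idx

/-- **The oracle language of the van Dam–Seroussi circuit.** [cite: BennettBernsteinBrassardVazirani1997, Cor. 4.15] -/
def lang : Language Bool := {w | specBit (parse w) = true}

/-- Membership in the oracle language is the answer bit of the parsed query. [folklore] -/
theorem mem_lang_iff (w : List Bool) : w ∈ lang ↔ specBit (parse w) = true := Iff.rfl

/-- The indicator of the oracle language is the answer bit. [folklore] -/
theorem boolIndicator_lang (w : List Bool) : Set.boolIndicator lang w = specBit (parse w) := by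
  unfold Set.boolIndicator lang
  simp only [Set.mem_setOf_eq]
  by_cases h : specBit (parse w) = true
  · rw [if_pos h, h]
  · rw [if_neg h]
    rw [Bool.not_eq_true] at h
    rw [h]

/-! ### The answers on the queries of the circuit -/

/-- The registers of a query whose register field is `r ++ r'` with `w₁ = |r|`. [folklore] -/
theorem r1_mk (p g a b tag idx L : ℕ) (r r' : List Bool) :
    Query.r1 ⟨p, g, a, b, tag, idx, L, r.length, r ++ r'⟩ = r ∧ Query.r2 ⟨p, g, a, b, tag, idx, L, r.length, r ++ r'⟩ = r' := by
  simp [Query.r1, Query.r2]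

/-- A padded numeral reads as its value. [folklore] -/
theorem bitsToNat_pad (n pad : ℕ) : bitsToNat (encodeNat n ++ List.replicate pad false) = n := by
  rw [bitsToNat_append_replicate_false, bitsToNat_encodeNat]

/-- **A factoring query** answers bit `idx` of the factorisation code. [cite: Shor1997, §5] -/
theorem specBit_fact (p g a b idx L w₁ : ℕ) (regs : List Bool) :
    specBit (parse (encodeQ (xOf p g a b) tagFACT idx L w₁ regs)) = (factCode p).getD idx false := by
  rw [parse_encodeQ]; rfl

/-- **A non-factoring query** answers bit `idx` of the value asked. [folklore] -/
theorem specBit_parse_encodeQ {tag : ℕ} (h : tag ≠ tagFACT) (p g a b idx L w₁ : ℕ) (regs : List Bool) :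
    specBit (parse (encodeQ (xOf p g a b) tag idx L w₁ regs)) = (valOf ⟨p, g, a, b, tag, idx, L, w₁, regs⟩).testBit idx := by
  rw [parse_encodeQ]
  exact if_neg h

/-- **The value of a discrete-logarithm query**: with a valid certificate (through padding) in the first
register and a unit `y` in the second, `ind_g(y)`. [cite: Shor1997, §6] [cite: VanDamSeroussi2002, §3 Lemma 1] -/
theorem valOf_dlog {p g : ℕ} {F : List ℕ} (hF : CertOK p (g % p) F) {y : ℕ} (hy0 : 0 < y) (hyp : y < p)
    (a b idx L : ℕ) (pad : List Bool) (r' : List Bool) (hr' : bitsToNat r' = y) :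
    valOf ⟨p, g, a, b, tagDLOG, idx, L, (certCode F ++ pad).length, (certCode F ++ pad) ++ r'⟩ = dlog p (g % p) y := by
  obtain ⟨h1, h2⟩ := r1_mk p g a b tagDLOG idx L (certCode F ++ pad) r'
  rw [valOf, if_pos rfl, h1, h2, parseF_certCode_append, hr', if_pos ⟨hF, hy0, hyp⟩]

/-- Off the promise (no valid certificate, or not a unit) a discrete-logarithm query has value `0`.
[folklore] -/
theorem valOf_dlog_of_not {p g a b idx L w₁ : ℕ} {regs : List Bool}
    (h : ¬ (CertOK p (g % p) (parseF (regs.take w₁)) ∧ 0 < bitsToNat (regs.drop w₁) ∧ bitsToNat (regs.drop w₁) < p)) :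
    valOf ⟨p, g, a, b, tagDLOG, idx, L, w₁, regs⟩ = 0 := by
  rw [valOf, if_pos rfl]
  exact if_neg h

/-- **The value of a phase query**: branch bit `s` in the first register (width `1`), `d` in the second.
[cite: VanDamSeroussi2002, §3 Lemma 1] -/
theorem valOf_phase (p g a b idx L : ℕ) (s : Bool) (r' : List Bool) :
    valOf ⟨p, g, a, b, tagPHASE, idx, L, 1, s :: r'⟩ = phaseNum p (expOf p a s) L (bitsToNat r') := by
  simp [valOf, Query.r1, Query.r2, tagDLOG, tagPHASE]

/-- **The values of the one-register arithmetic queries** (`w₁ = |r|`). [cite: VanDamSeroussi2002, §4 Algorithm 1] [cite: Hales2002, Ch. 5 §1 Algorithm 3] -/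
theorem valOf_one (p g a b idx L : ℕ) (r : List Bool) :
    valOf ⟨p, g, a, b, tagYOFT, idx, L, r.length, r⟩ = yOfT p (bitsToNat r) ∧
    valOf ⟨p, g, a, b, tagQOFT, idx, L, r.length, r⟩ = qOfT p (bitsToNat r) ∧
    valOf ⟨p, g, a, b, tagMODP, idx, L, r.length, r⟩ = bitsToNat r % p ∧
    valOf ⟨p, g, a, b, tagDIVP, idx, L, r.length, r⟩ = bitsToNat r / p ∧
    valOf ⟨p, g, a, b, tagKOF, idx, L, r.length, r⟩ = kOf p (2 ^ r.length) (bitsToNat r) ∧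
    valOf ⟨p, g, a, b, tagOFF, idx, L, r.length, r⟩ = rOff p (2 ^ r.length) (kOf p (2 ^ r.length) (bitsToNat r)) (bitsToNat r) := by
  simp [valOf, Query.r1, tagDLOG, tagPHASE, tagYOFT, tagQOFT, tagTOFQY, tagADDMUL, tagMODP, tagDIVP, tagKOF, tagOFF]

/-- **The values of the two-register arithmetic queries** (`w₁ = |r|`, registers `r ++ r'`).
[cite: VanDamSeroussi2002, §4 Algorithm 1] [cite: Hales2002, Ch. 5 §1 Algorithm 3] -/
theorem valOf_two (p g a b idx L : ℕ) (r r' : List Bool) :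
    valOf ⟨p, g, a, b, tagTOFQY, idx, L, r.length, r ++ r'⟩ = tOfQY p (bitsToNat r) (bitsToNat r') ∧
    valOf ⟨p, g, a, b, tagADDMUL, idx, L, r.length, r ++ r'⟩ = addMul p (bitsToNat r) (bitsToNat r') ∧
    valOf ⟨p, g, a, b, tagUNZ, idx, L, r.length, r ++ r'⟩ = unz p (2 ^ L) (bitsToNat r) (bitsToNat r') := by
  simp [valOf, Query.r1, Query.r2, tagDLOG, tagPHASE, tagYOFT, tagQOFT, tagTOFQY, tagADDMUL, tagMODP, tagDIVP, tagKOF,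
    tagOFF, tagUNZ]

end VDSOracle

end Literature.Computability.Cryptography

end
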